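import Literature.AnabelianGeometry.SemiGraphs.TemperedCompactPairUnfoldedCrossing
import HarnessLib

/-!
# Two subgroups of `π₁^temp(𝒢)` at tree distance `≥ 2`: the ENTRY branch of the unfolded crossings is PINNED

Mochizuki, *Semi-graphs of anabelioids*, Publ. RIMS **42** (2006), §1, Lemma 1.8 (ii) p. 20, §3, Theorem 3.7
(iii)/(iv) pp. 40–41 [cite: MochizukiSemiAnbd2006, Thm 3.7(iv) p.41].

PROOF-ONLY tool file (abc-iut cell, layer L3, row «T37iv-S2@RELATIVE-BRIDGE», file F6, seat abc-iut-L3-t8 gen 10;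
no definition, no named fact).  Sharpening of `exists_unfolded_crossing` (F3b, `TemperedCompactPairUnfoldedCrossing.lean`):
in the third regime of the trichotomy (no common fixed vertex and no bridge at level `m`), the unfolded crossings of
the separating vertex `z` at the deeper levels all ENTER through ONE branch `β_A` of `𝒢_{∞,m}` at `z` (the branch
towards the fixed locus on whose side `z` was chosen) and EXIT through branches distinct from `β_A`.  For ANY
countable `𝒢` with the hypotheses of Prop. 3.6, canonical tower, ANY subgroups:

* `SemiGraph.branch_eq_of_reaches_avoiding` — in a tree at most ONE branch at a vertex `z` has its point joined
  to a given vertex `a₀` by a walk avoiding `z`;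
* `exists_sided_unfolded_crossing_of_separating_vertex` — the one-sided engine of F3b with the SIDES recorded: the
  entry branch point reaches `a₀` avoiding `z`, the exit branch point does not;
* ★ `exists_pinned_unfolded_crossing` — no common fixed vertex and no bridge at level `m` ⇒ a vertex `z` fixed by
  neither `K₁` nor `K₂` and a branch `β_A` at `z` such that at every level `M ≥ m` every walk from a `K₁`-fixed to a
  `K₂`-fixed vertex of `𝒢_{∞,M}` contains a vertex over `z` with two branches on the walk, one over `β_A` and one
  over a branch `≠ β_A`;
* ★★ `anchored_or_pinned_unfolded_of_not_isCompact` — compact `K₁`, `K₂` with non-compact join: anchored, or a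
  persistent `K₁ ⊓ K₂`-fixed branch over the ONE level branch `β_A` together with a second fixed branch at the same
  vertex whose image is a branch `≠ β_A` at `z`, at every deeper level (so `K₁ ⊓ K₂` has a persistent BRANCH type
  without a compatible thread being asserted).

Honest framing: generic statements about OUR typed `π₁^temp`; nothing bears on [IUTchIII] Cor. 3.12; typed ≠ proved.
-/
noncomputable section

open CategoryTheory Topology

namespace Literature.AnabelianGeometry.SemiGraphs

open SimpleGraph

universe u

namespace SemiGraph

variable {T : SemiGraph.{u}}

/-- **In a tree at most one branch at `z` reaches `a₀` avoiding `z`**: if the points of two branches `b₁`, `b₂`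
abutting to `z` are both joined to the vertex `a₀` by walks avoiding the point of `z`, then `b₁ = b₂` (otherwise the
unique path `b₁ – z – b₂` between their points would lie on the composite walk, which avoids `z`).
[cite: MochizukiSemiAnbd2006, Lem. 1.8(ii) p.20] -/
theorem branch_eq_of_reaches_avoiding (hT : T.IsTree) {z a₀ : T.Vertex} {b₁ b₂ : T.Branch}
    (hb₁ : T.abuts b₁ = some z) (hb₂ : T.abuts b₂ = some z)
    (p₁ : T.subdivision.Walk (Sum.inr (Sum.inr b₁)) (Sum.inl a₀)) (hp₁ : (Sum.inl z : T.Node) ∉ p₁.support)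
    (p₂ : T.subdivision.Walk (Sum.inr (Sum.inr b₂)) (Sum.inl a₀)) (hp₂ : (Sum.inl z : T.Node) ∉ p₂.support) :
    b₁ = b₂ := by
  classical
  by_contra hne
  -- the path `b₁ – z – b₂`
  have h1 : T.subdivision.Adj (Sum.inr (Sum.inr b₁)) (Sum.inl z) :=
    (T.subdivision_adj_branch_iff b₁ _).mpr (Or.inr ⟨z, hb₁, rfl⟩)
  have h2 : T.subdivision.Adj (Sum.inl z) (Sum.inr (Sum.inr b₂)) :=
    (T.subdivision_adj_inl_iff z _).mpr ⟨b₂, hb₂, rfl⟩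
  let q : T.subdivision.Walk (Sum.inr (Sum.inr b₁)) (Sum.inr (Sum.inr b₂)) := Walk.cons h1 (Walk.cons h2 Walk.nil)
  have hq : q.IsPath := by
    have hb : (Sum.inr (Sum.inr b₁) : T.Node) ≠ Sum.inr (Sum.inr b₂) := fun h => hne (by simpa using h)
    simp [q, Walk.cons_isPath_iff, hb]
  -- the composite walk `b₁ → a₀ → b₂` avoids `z`; its bypass is the path `q`
  let r : T.subdivision.Walk (Sum.inr (Sum.inr b₁)) (Sum.inr (Sum.inr b₂)) := p₁.append p₂.reverse
  have hr : (Sum.inl z : T.Node) ∉ r.support := by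
    rw [Walk.support_append, List.mem_append, Walk.support_reverse, not_or]
    exact ⟨hp₁, fun h => hp₂ (List.mem_reverse.mp (List.tail_subset _ h))⟩
  have heq : r.bypass = q := by
    have := hT.isTree.isAcyclic.path_unique ⟨r.bypass, r.bypass_isPath⟩ ⟨q, hq⟩
    exact congrArg Subtype.val this
  have hz : (Sum.inl z : T.Node) ∈ r.bypass.support := by
    rw [heq]
    simp [q]
  exact hr (r.support_bypass_subset_support hz)

end SemiGraph

namespace ProfiniteSemiGraph

variable {𝒢 : ProfiniteSemiGraph.{u}}

/-! ### The one-sided engine with sides recorded -/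

/-- **One-sided engine, sides recorded** (cf. `exists_unfolded_crossing_of_separating_vertex`): with `z` not fixed by
`Q`, every walk from a `Q`-fixed vertex to `a₀` passing `z` and every `P`-fixed vertex reaching `a₀` avoiding `z`, every
walk of `𝒢_{∞,M}` (`M ≥ m`) from a `P`-fixed to a `Q`-fixed vertex contains a vertex `w̃` over `z` with two branches on
the walk such that the image point of the first REACHES `a₀` AVOIDING `z` and that of the second does NOT.
[cite: MochizukiSemiAnbd2006, Lem. 1.8(ii) p.20] -/
theorem exists_sided_unfolded_crossing_of_separating_vertex (h36 : 𝒢.Prop36Hypotheses)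
    (P Q : Subgroup ((𝒢.galoisLevelData h36).temperedPi h36.isCountable)) (m : ℕ)
    (z a₀ : ((𝒢.galoisLevelData h36).tree m).Vertex)
    (hzQ : ¬ ∀ k ∈ Q, ((𝒢.galoisLevelData h36).treeAct h36.isCountable m k).hom.vertexMap z = z)
    (hQ : ∀ b : ((𝒢.galoisLevelData h36).tree m).Vertex,
      (∀ k ∈ Q, ((𝒢.galoisLevelData h36).treeAct h36.isCountable m k).hom.vertexMap b = b) →
      ∀ q : ((𝒢.galoisLevelData h36).tree m).subdivision.Walk (Sum.inl b) (Sum.inl a₀),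
        (Sum.inl z : ((𝒢.galoisLevelData h36).tree m).Node) ∈ q.support)
    (hP : ∀ a : ((𝒢.galoisLevelData h36).tree m).Vertex,
      (∀ k ∈ P, ((𝒢.galoisLevelData h36).treeAct h36.isCountable m k).hom.vertexMap a = a) →
      ∃ p : ((𝒢.galoisLevelData h36).tree m).subdivision.Walk (Sum.inl a) (Sum.inl a₀),
        (Sum.inl z : ((𝒢.galoisLevelData h36).tree m).Node) ∉ p.support)
    (M : ℕ) (hmM : m ≤ M) {v u : ((𝒢.galoisLevelData h36).tree M).Vertex}
    (hv : ∀ k ∈ P, ((𝒢.galoisLevelData h36).treeAct h36.isCountable M k).hom.vertexMap v = v)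
    (hu : ∀ k ∈ Q, ((𝒢.galoisLevelData h36).treeAct h36.isCountable M k).hom.vertexMap u = u)
    (γ : ((𝒢.galoisLevelData h36).tree M).subdivision.Walk (Sum.inl v) (Sum.inl u)) :
    ∃ (w : ((𝒢.galoisLevelData h36).tree M).Vertex) (β β' : ((𝒢.galoisLevelData h36).tree M).Branch),
      (Sum.inl w : ((𝒢.galoisLevelData h36).tree M).Node) ∈ γ.support ∧
      (Sum.inr (Sum.inr β) : ((𝒢.galoisLevelData h36).tree M).Node) ∈ γ.support ∧
      (Sum.inr (Sum.inr β') : ((𝒢.galoisLevelData h36).tree M).Node) ∈ γ.support ∧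
      ((𝒢.galoisLevelData h36).tree M).abuts β = some w ∧ ((𝒢.galoisLevelData h36).tree M).abuts β' = some w ∧
      ((𝒢.galoisLevelData h36).treeTrans hmM).vertexMap w = z ∧
      (∃ p : ((𝒢.galoisLevelData h36).tree m).subdivision.Walk
          (Sum.inr (Sum.inr (((𝒢.galoisLevelData h36).treeTrans hmM).branchMap β))) (Sum.inl a₀),
        (Sum.inl z : ((𝒢.galoisLevelData h36).tree m).Node) ∉ p.support) ∧
      ∀ p : ((𝒢.galoisLevelData h36).tree m).subdivision.Walk
          (Sum.inr (Sum.inr (((𝒢.galoisLevelData h36).treeTrans hmM).branchMap β'))) (Sum.inl a₀),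
        (Sum.inl z : ((𝒢.galoisLevelData h36).tree m).Node) ∈ p.support := by
  classical
  let Dg := 𝒢.galoisLevelData h36
  have hc := h36.isCountable
  let D₀ : VerticialLevelData.{0} 𝒢 (𝒢.temperedPiChart h36) := verticialLevelData_temperedPiChart (h36 := h36)
  let T := Dg.tree m
  let π := Dg.treeTrans hmM
  have hpush : ∀ (K : Subgroup (Dg.temperedPi hc)) (x : (Dg.tree M).Vertex),
      (∀ k ∈ K, (Dg.treeAct hc M k).hom.vertexMap x = x) →
      ∀ k ∈ K, (Dg.treeAct hc m k).hom.vertexMap (π.vertexMap x) = π.vertexMap x := by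
    intro K x hx k hk
    have h : π.vertexMap ((Dg.treeAct hc M k).hom.vertexMap x) =
        (Dg.treeAct hc m k).hom.vertexMap (π.vertexMap x) := D₀.trans_act_vertexMap hmM k x
    rw [hx k hk] at h
    exact h.symm
  let c : T.Node := Sum.inl z
  let D : Set T.Node := {n | ∃ p : T.subdivision.Walk n (Sum.inl a₀), c ∉ p.support}
  have hD : ∀ n n' : T.Node, n ∈ D → T.subdivision.Adj n n' → n' ≠ c → n' ∈ D := by
    rintro n n' ⟨p, hp⟩ hnn' hn'
    refine ⟨Walk.cons hnn'.symm p, ?_⟩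
    rw [Walk.support_cons, List.mem_cons, not_or]
    exact ⟨fun h => hn' h.symm, hp⟩
  let f : (Dg.tree M).Node → T.Node := SemiGraph.Hom.nodeMap π
  have hf : ∀ x y, (Dg.tree M).subdivision.Adj x y → T.subdivision.Adj (f x) (f y) :=
    fun x y h => (Dg.tree M).subdivision_adj_map π h
  have hs : f (Sum.inl v) ∈ D := hP (π.vertexMap v) (hpush P v hv)
  have ht : f (Sum.inl u) ∉ D := by
    rintro ⟨p, hp⟩
    exact hp (hQ (π.vertexMap u) (hpush Q u hu) p)
  have htc : f (Sum.inl u) ≠ c := by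
    intro h
    have huz : π.vertexMap u = z := Sum.inl_injective h
    exact hzQ (huz ▸ hpush Q u hu)
  obtain ⟨g, g', g'', hg, hg', hg'', hgg', hg'g'', hgD, hg'c, hg''D, -⟩ :=
    SemiGraph.exists_crossing_of_walk f hf c D hD ht htc γ.length γ rfl hs
  rcases g' with w | e | b
  · have hw : π.vertexMap w = z := Sum.inl_injective hg'c
    obtain ⟨β, hβ, rfl⟩ := ((Dg.tree M).subdivision_adj_inl_iff w g).mp hgg'.symm
    obtain ⟨β', hβ', rfl⟩ := ((Dg.tree M).subdivision_adj_inl_iff w g'').mp hg'g''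
    obtain ⟨p, hp⟩ := hgD
    refine ⟨w, β, β', hg', hg, hg'', hβ, hβ', hw, ⟨p, hp⟩, fun p' => ?_⟩
    by_contra hp'
    exact hg''D ⟨p', hp'⟩
  · exact absurd hg'c (by simp [f, c, SemiGraph.Hom.nodeMap])
  · exact absurd hg'c (by simp [f, c, SemiGraph.Hom.nodeMap])

/-! ### ★ The entry branch is pinned -/

/-- ★ **PINNED UNFOLDED CROSSINGS.**  If `K₁` (fixing `a₀`) and `K₂` (fixing `b₀`) fix no common vertex of `𝒢_{∞,m}`
and `𝒢_{∞,m}` carries NO bridge, there are a vertex `z` of `𝒢_{∞,m}` fixed by NEITHER and a branch `β_A` abutting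
to `z` such that at EVERY level `M ≥ m` EVERY walk of `𝒢_{∞,M}` from a `K₁`-fixed to a `K₂`-fixed vertex contains a
vertex `w̃` over `z` with two of its branches on the walk, one lying OVER `β_A` and the other over a branch `≠ β_A`
(the sided engine + uniqueness of the branch at `z` reaching the fixed locus on the chosen side avoiding `z`).
[cite: MochizukiSemiAnbd2006, Thm 3.7(iv) p.41] -/
theorem exists_pinned_unfolded_crossing (h36 : 𝒢.Prop36Hypotheses)
    (K₁ K₂ : Subgroup ((𝒢.galoisLevelData h36).temperedPi h36.isCountable)) (m : ℕ)
    (hno : ∀ z : ((𝒢.galoisLevelData h36).tree m).Vertex,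
      (∀ k ∈ K₁, ((𝒢.galoisLevelData h36).treeAct h36.isCountable m k).hom.vertexMap z = z) →
        ¬ ∀ k ∈ K₂, ((𝒢.galoisLevelData h36).treeAct h36.isCountable m k).hom.vertexMap z = z)
    (hnobr : ¬ ∃ (x y : ((𝒢.galoisLevelData h36).tree m).Vertex) (β₁ β₂ : ((𝒢.galoisLevelData h36).tree m).Branch),
      β₁ ≠ β₂ ∧ ((𝒢.galoisLevelData h36).tree m).edgeOf β₁ = ((𝒢.galoisLevelData h36).tree m).edgeOf β₂ ∧
      ((𝒢.galoisLevelData h36).tree m).abuts β₁ = some x ∧ ((𝒢.galoisLevelData h36).tree m).abuts β₂ = some y ∧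
      (∀ k ∈ K₁, ((𝒢.galoisLevelData h36).treeAct h36.isCountable m k).hom.vertexMap x = x) ∧
      ∀ k ∈ K₂, ((𝒢.galoisLevelData h36).treeAct h36.isCountable m k).hom.vertexMap y = y)
    {a₀ b₀ : ((𝒢.galoisLevelData h36).tree m).Vertex}
    (ha₀ : ∀ k ∈ K₁, ((𝒢.galoisLevelData h36).treeAct h36.isCountable m k).hom.vertexMap a₀ = a₀)
    (hb₀ : ∀ k ∈ K₂, ((𝒢.galoisLevelData h36).treeAct h36.isCountable m k).hom.vertexMap b₀ = b₀) :
    ∃ (z : ((𝒢.galoisLevelData h36).tree m).Vertex) (βA : ((𝒢.galoisLevelData h36).tree m).Branch),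
      (¬ ∀ k ∈ K₁, ((𝒢.galoisLevelData h36).treeAct h36.isCountable m k).hom.vertexMap z = z) ∧
      (¬ ∀ k ∈ K₂, ((𝒢.galoisLevelData h36).treeAct h36.isCountable m k).hom.vertexMap z = z) ∧
      ((𝒢.galoisLevelData h36).tree m).abuts βA = some z ∧
      ∀ (M : ℕ) (hmM : m ≤ M) (v u : ((𝒢.galoisLevelData h36).tree M).Vertex),
        (∀ k ∈ K₁, ((𝒢.galoisLevelData h36).treeAct h36.isCountable M k).hom.vertexMap v = v) →
        (∀ k ∈ K₂, ((𝒢.galoisLevelData h36).treeAct h36.isCountable M k).hom.vertexMap u = u) →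
        ∀ γ : ((𝒢.galoisLevelData h36).tree M).subdivision.Walk (Sum.inl v) (Sum.inl u),
          ∃ (w : ((𝒢.galoisLevelData h36).tree M).Vertex) (β β' : ((𝒢.galoisLevelData h36).tree M).Branch),
            (Sum.inl w : ((𝒢.galoisLevelData h36).tree M).Node) ∈ γ.support ∧
            (Sum.inr (Sum.inr β) : ((𝒢.galoisLevelData h36).tree M).Node) ∈ γ.support ∧
            (Sum.inr (Sum.inr β') : ((𝒢.galoisLevelData h36).tree M).Node) ∈ γ.support ∧
            ((𝒢.galoisLevelData h36).tree M).abuts β = some w ∧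
            ((𝒢.galoisLevelData h36).tree M).abuts β' = some w ∧
            ((𝒢.galoisLevelData h36).treeTrans hmM).vertexMap w = z ∧
            ((𝒢.galoisLevelData h36).treeTrans hmM).branchMap β = βA ∧
            ((𝒢.galoisLevelData h36).treeTrans hmM).branchMap β' ≠ βA := by
  classical
  let Dg := 𝒢.galoisLevelData h36
  have hT := Dg.isTree_tree m
  obtain ⟨e₀, b₁, b₂, z₁, z₂, h12, hb₁, hb₂, hz₁, hz₂, hsep, hp₁, hb₂R, hp₂, hb₁R⟩ :=
    exists_separating_edge_data h36 K₁ K₂ m hno ha₀ hb₀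
  have hsep' : ∀ b a : (Dg.tree m).Vertex,
      (∀ k ∈ K₂, (Dg.treeAct h36.isCountable m k).hom.vertexMap b = b) →
      (∀ k ∈ K₁, (Dg.treeAct h36.isCountable m k).hom.vertexMap a = a) →
      ∀ w : (Dg.tree m).subdivision.Walk (Sum.inl b) (Sum.inl a),
        (Sum.inr (Sum.inl e₀) : (Dg.tree m).Node) ∈ w.support := by
    intro b a hb ha w
    have h := hsep a b ha hb w.reverse
    rwa [Walk.support_reverse, List.mem_reverse] at h
  -- generic packaging: from the sided engine at `(P, Q, z, a)` to the pinned statement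
  have pack : ∀ (P Q : Subgroup (Dg.temperedPi h36.isCountable)) (z a : (Dg.tree m).Vertex), z ≠ a →
      (¬ ∀ k ∈ Q, (Dg.treeAct h36.isCountable m k).hom.vertexMap z = z) →
      (∀ b : (Dg.tree m).Vertex, (∀ k ∈ Q, (Dg.treeAct h36.isCountable m k).hom.vertexMap b = b) →
        ∀ q : (Dg.tree m).subdivision.Walk (Sum.inl b) (Sum.inl a), (Sum.inl z : (Dg.tree m).Node) ∈ q.support) →
      (∀ a' : (Dg.tree m).Vertex, (∀ k ∈ P, (Dg.treeAct h36.isCountable m k).hom.vertexMap a' = a') →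
        ∃ p : (Dg.tree m).subdivision.Walk (Sum.inl a') (Sum.inl a), (Sum.inl z : (Dg.tree m).Node) ∉ p.support) →
      ∃ βA : (Dg.tree m).Branch, (Dg.tree m).abuts βA = some z ∧
      ∀ (M : ℕ) (hmM : m ≤ M) (v u : (Dg.tree M).Vertex),
        (∀ k ∈ P, (Dg.treeAct h36.isCountable M k).hom.vertexMap v = v) →
        (∀ k ∈ Q, (Dg.treeAct h36.isCountable M k).hom.vertexMap u = u) →
        ∀ γ : (Dg.tree M).subdivision.Walk (Sum.inl v) (Sum.inl u),
          ∃ (w : (Dg.tree M).Vertex) (β β' : (Dg.tree M).Branch),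
            (Sum.inl w : (Dg.tree M).Node) ∈ γ.support ∧ (Sum.inr (Sum.inr β) : (Dg.tree M).Node) ∈ γ.support ∧
            (Sum.inr (Sum.inr β') : (Dg.tree M).Node) ∈ γ.support ∧
            (Dg.tree M).abuts β = some w ∧ (Dg.tree M).abuts β' = some w ∧ (Dg.treeTrans hmM).vertexMap w = z ∧
            (Dg.treeTrans hmM).branchMap β = βA ∧ (Dg.treeTrans hmM).branchMap β' ≠ βA := by
    intro P Q z a hza hzQ hQ hP
    -- the branch `βA` at `z` towards `a`: second node of the geodesic `[z, a]`, whose tail avoids `z`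
    obtain ⟨p₀, hp₀, -⟩ := (hT.isTree.connected (Sum.inl z : (Dg.tree m).Node) (Sum.inl a)).exists_path_of_dist
    obtain ⟨βA, hβA, pA, hpA⟩ : ∃ (βA : (Dg.tree m).Branch) (_ : (Dg.tree m).abuts βA = some z)
        (pA : (Dg.tree m).subdivision.Walk (Sum.inr (Sum.inr βA)) (Sum.inl a)),
        (Sum.inl z : (Dg.tree m).Node) ∉ pA.support := by
      cases p₀ with
      | nil => exact absurd rfl hza
      | @cons _ n₁ _ h p' =>
        rw [Walk.cons_isPath_iff] at hp₀
        obtain ⟨βA, hβA, rfl⟩ := ((Dg.tree m).subdivision_adj_inl_iff z n₁).mp h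
        exact ⟨βA, hβA, p', hp₀.2⟩
    refine ⟨βA, hβA, fun M hmM v u hv hu γ => ?_⟩
    obtain ⟨w, β, β', hw, hβ, hβ', hβw, hβ'w, hwz, ⟨p, hp⟩, hout⟩ :=
      exists_sided_unfolded_crossing_of_separating_vertex h36 P Q m z a hzQ hQ hP M hmM hv hu γ
    have hβz : (Dg.tree m).abuts ((Dg.treeTrans hmM).branchMap β) = some z := by
      rw [(Dg.treeTrans hmM).abuts_branchMap β w hβw, hwz]
    have hin : (Dg.treeTrans hmM).branchMap β = βA :=
      SemiGraph.branch_eq_of_reaches_avoiding hT hβz hβA p hp pA hpA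
    exact ⟨w, β, β', hw, hβ, hβ', hβw, hβ'w, hwz, hin, fun h => by subst h; exact hpA (hout pA)⟩
  by_cases hz₁K : ∀ k ∈ K₁, (Dg.treeAct h36.isCountable m k).hom.vertexMap z₁ = z₁
  · -- from the side of `K₂`: `z = z₂`, towards `b₀`
    have hz₂K : ¬ ∀ k ∈ K₂, (Dg.treeAct h36.isCountable m k).hom.vertexMap z₂ = z₂ :=
      fun h => hnobr ⟨z₁, z₂, b₁, b₂, h12, hb₁.trans hb₂.symm, hz₁, hz₂, hz₁K, h⟩
    obtain ⟨hz₂K₁, hQ, hP⟩ := separating_vertex_package h36 K₂ K₁ m h12.symm hb₂ hb₁ hz₂ hb₀ hsep' hp₂ hb₁R hz₂K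
    have hza : z₂ ≠ b₀ := fun h => hz₂K (h ▸ hb₀)
    obtain ⟨βA, hβA, hpack⟩ := pack K₂ K₁ z₂ b₀ hza hz₂K₁ hQ hP
    refine ⟨z₂, βA, hz₂K₁, hz₂K, hβA, fun M hmM v u hv hu γ => ?_⟩
    obtain ⟨w, β, β', hw, hβ, hβ', hβw, hβ'w, hwz, hin, hout⟩ := hpack M hmM u v hu hv γ.reverse
    rw [Walk.support_reverse, List.mem_reverse] at hw hβ hβ'
    exact ⟨w, β, β', hw, hβ, hβ', hβw, hβ'w, hwz, hin, hout⟩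
  · -- from the side of `K₁`: `z = z₁`, towards `a₀`
    obtain ⟨hz₁K₂, hQ, hP⟩ := separating_vertex_package h36 K₁ K₂ m h12 hb₁ hb₂ hz₁ ha₀ hsep hp₁ hb₂R hz₁K
    have hza : z₁ ≠ a₀ := fun h => hz₁K (h ▸ ha₀)
    obtain ⟨βA, hβA, hpack⟩ := pack K₁ K₂ z₁ a₀ hza hz₁K₂ hQ hP
    exact ⟨z₁, βA, hz₁K, hz₁K₂, hβA, fun M hmM v u hv hu γ => hpack M hmM v u hv hu γ⟩


/-- ★★ **THE TRICHOTOMY with PINNED ENTRY.**  Let `K₁, K₂ ≤ π₁^temp(𝒢)` be COMPACT with `(K₁ ⊔ K₂)‾` NOT compact.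
Then EITHER `K₁`, `K₂` lie in verticial subgroups and `K₁ ⊓ K₂` in an edge-like subgroup, OR there are a level `m`, a
vertex `z` of `𝒢_{∞,m}` fixed by NEITHER and a branch `β_A` at `z` such that EVERY level `M ≥ m` carries a vertex
`w̃` over `z` with two branches at `w̃`, one OVER `β_A` (a persistent `K₁ ⊓ K₂`-fixed branch over ONE level branch) and
one over a branch `≠ β_A`, all three FIXED by EVERY `d ∈ K₁ ⊓ K₂`. [cite: MochizukiSemiAnbd2006, Thm 3.7(iv) p.41] -/
theorem anchored_or_pinned_unfolded_of_not_isCompact (h36 : 𝒢.Prop36Hypotheses)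
    (K₁ K₂ : Subgroup ((𝒢.galoisLevelData h36).temperedPi h36.isCountable))
    (hK₁ : IsCompact (K₁ : Set ((𝒢.galoisLevelData h36).temperedPi h36.isCountable)))
    (hK₂ : IsCompact (K₂ : Set ((𝒢.galoisLevelData h36).temperedPi h36.isCountable)))
    (hK : ¬ IsCompact (((K₁ ⊔ K₂).topologicalClosure :
      Subgroup ((𝒢.galoisLevelData h36).temperedPi h36.isCountable)) :
        Set ((𝒢.galoisLevelData h36).temperedPi h36.isCountable))) :
    ((∃ (v : 𝒢.graph.Vertex) (H : Subgroup (𝒢.temperedPiChart h36).G),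
        H ∈ verticialSubgroups (𝒢.temperedPiChart h36) v ∧ K₁ ≤ H) ∧
      (∃ (v : 𝒢.graph.Vertex) (H : Subgroup (𝒢.temperedPiChart h36).G),
        H ∈ verticialSubgroups (𝒢.temperedPiChart h36) v ∧ K₂ ≤ H) ∧
      ∃ (e : 𝒢.graph.Edge) (L : Subgroup (𝒢.temperedPiChart h36).G),
        L ∈ edgeLikeSubgroups (𝒢.temperedPiChart h36) e ∧ K₁ ⊓ K₂ ≤ L) ∨
    ∃ (m : ℕ) (z : ((𝒢.galoisLevelData h36).tree m).Vertex) (βA : ((𝒢.galoisLevelData h36).tree m).Branch),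
      (¬ ∀ k ∈ K₁, ((𝒢.galoisLevelData h36).treeAct h36.isCountable m k).hom.vertexMap z = z) ∧
      (¬ ∀ k ∈ K₂, ((𝒢.galoisLevelData h36).treeAct h36.isCountable m k).hom.vertexMap z = z) ∧
      ((𝒢.galoisLevelData h36).tree m).abuts βA = some z ∧
      ∀ (M : ℕ) (hmM : m ≤ M),
        ∃ (w : ((𝒢.galoisLevelData h36).tree M).Vertex) (β β' : ((𝒢.galoisLevelData h36).tree M).Branch),
          ((𝒢.galoisLevelData h36).tree M).abuts β = some w ∧ ((𝒢.galoisLevelData h36).tree M).abuts β' = some w ∧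
          ((𝒢.galoisLevelData h36).treeTrans hmM).vertexMap w = z ∧
          ((𝒢.galoisLevelData h36).treeTrans hmM).branchMap β = βA ∧
          ((𝒢.galoisLevelData h36).treeTrans hmM).branchMap β' ≠ βA ∧
          ∀ d ∈ K₁ ⊓ K₂,
            ((𝒢.galoisLevelData h36).treeAct h36.isCountable M d).hom.vertexMap w = w ∧
            ((𝒢.galoisLevelData h36).treeAct h36.isCountable M d).hom.branchMap β = β ∧
            ((𝒢.galoisLevelData h36).treeAct h36.isCountable M d).hom.branchMap β' = β' := by
  classical
  let Dg := 𝒢.galoisLevelData h36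
  have hc := h36.isCountable
  let D₀ : VerticialLevelData.{0} 𝒢 (𝒢.temperedPiChart h36) := verticialLevelData_temperedPiChart (h36 := h36)
  obtain ⟨m, hm⟩ : ∃ m : ℕ, ∀ z : (Dg.tree m).Vertex,
      (∀ k ∈ K₁, (Dg.treeAct hc m k).hom.vertexMap z = z) → ¬ ∀ k ∈ K₂, (Dg.treeAct hc m k).hom.vertexMap z = z := by
    by_contra h
    push Not at h
    exact hK (isCompact_topologicalClosure_sup_of_forall_exists_common_fixed_vertex h36 K₁ K₂
      fun m => by obtain ⟨z, hz₁, hz₂⟩ := h m; exact ⟨z, hz₁, hz₂⟩)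
  by_cases hbr : ∀ M : ℕ, m ≤ M → ∃ (x y : (Dg.tree M).Vertex) (β₁ β₂ : (Dg.tree M).Branch), β₁ ≠ β₂ ∧
      (Dg.tree M).edgeOf β₁ = (Dg.tree M).edgeOf β₂ ∧ (Dg.tree M).abuts β₁ = some x ∧ (Dg.tree M).abuts β₂ = some y ∧
      (∀ k ∈ K₁, (Dg.treeAct hc M k).hom.vertexMap x = x) ∧ ∀ k ∈ K₂, (Dg.treeAct hc M k).hom.vertexMap y = y
  · left
    obtain ⟨h₁, h₂⟩ := exists_verticial_ge_of_forall_exists_bridge h36 K₁ K₂ m hm hbr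
    exact ⟨h₁, h₂, exists_edgeLike_ge_inf_of_forall_exists_bridge h36 K₁ K₂ m hm hbr⟩
  · right
    push Not at hbr
    obtain ⟨M₀, hmM₀, hnobr⟩ := hbr
    have hno₀ : ∀ z : (Dg.tree M₀).Vertex, (∀ k ∈ K₁, (Dg.treeAct hc M₀ k).hom.vertexMap z = z) →
        ¬ ∀ k ∈ K₂, (Dg.treeAct hc M₀ k).hom.vertexMap z = z :=
      fun z hz => forall_not_common_fixed_of_le h36 K₁ K₂ hmM₀ hm z hz
    obtain ⟨a₀, ha₀⟩ := D₀.exists_forall_mem_fixed_vertex_of_isCompact K₁ hK₁ M₀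
    obtain ⟨b₀, hb₀⟩ := D₀.exists_forall_mem_fixed_vertex_of_isCompact K₂ hK₂ M₀
    obtain ⟨z, βA, hz₁, hz₂, hβA, hcross⟩ := exists_pinned_unfolded_crossing h36 K₁ K₂ M₀ hno₀
      (fun ⟨x, y, β₁, β₂, h12, he, hx, hy, hxK, hyK⟩ => by
        obtain ⟨k, hk, hne⟩ := hnobr x y β₁ β₂ h12 he hx hy hxK
        exact hne (hyK k hk)) ha₀ hb₀
    refine ⟨M₀, z, βA, hz₁, hz₂, hβA, fun M hM => ?_⟩
    obtain ⟨v, hv⟩ := D₀.exists_forall_mem_fixed_vertex_of_isCompact K₁ hK₁ M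
    obtain ⟨u, hu⟩ := D₀.exists_forall_mem_fixed_vertex_of_isCompact K₂ hK₂ M
    obtain ⟨γ, hγp, -⟩ := ((Dg.isTree_tree M).isTree.connected
      (Sum.inl v : (Dg.tree M).Node) (Sum.inl u)).exists_path_of_dist
    obtain ⟨w, β, β', hw, hβ, hβ', hβw, hβ'w, hwz, hin, hout⟩ := hcross M hM v u hv hu γ
    refine ⟨w, β, β', hβw, hβ'w, hwz, hin, hout, fun d hd => ?_⟩
    obtain ⟨hd₁, hd₂⟩ := Subgroup.mem_inf.mp hd
    obtain ⟨hfixV, hfixB⟩ := fixes_of_mem_support_path h36 M d (hv d hd₁) (hu d hd₂) γ hγp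
    exact ⟨hfixV w hw, hfixB β hβ, hfixB β' hβ'⟩

end ProfiniteSemiGraph

end Literature.AnabelianGeometry.SemiGraphs

end
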